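import Summits.BirchSwinnertonDyer.BirchSwinnertonDyer.Theorems.TangentConeSelmerRankSmallImageReduction
import Literature.NumberTheory.EllipticCurves.ComplexMultiplicationHasCMProofs
import Literature.NumberTheory.EllipticCurves.RationalIsogenyFrobeniusCriterion
import Literature.NumberTheory.EllipticCurves.PointCountEulerCriterion
import Literature.NumberTheory.EllipticCurves.ComplexMultiplicationLocalFactorsAux
import Literature.NumberTheory.EllipticCurves.SzpiroLocalDataProofs
import Literature.NumberTheory.EllipticCurves.DegreeConjectureAbcPrelims
import Literature.NumberTheory.EllipticCurves.ModPImageJ1728CartanProofs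
import Summits.BirchSwinnertonDyer.BirchSwinnertonDyer.Theorems.SelmerRankCM.Negative.ConsequencesOfCrux
import Summits.BirchSwinnertonDyer.BirchSwinnertonDyer.Theorems.SelmerRankCM.Negative.GoodReductionNotRedundant
import Literature.NumberTheory.EllipticCurves.RootNumberTwistProofs

/-!
# Disproof of `SelmerRankCM` (stmt-BirchSwinnertonDyer-18086) — findings: NO KILL; not vacuous;
# no hypothesis is load-bearing for truth; crux = CM sector of the summit modulo Ш[p^∞]-finiteness;
# (cycle 1) `hgood` is formally load-bearing (additive cells, `frobeniusTrace = 1` there); the crux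
# ALONE gives weak BSD `rank ≤ r_an` for CM curves and prime-independence of `Ш[p^∞]`-finiteness

Seeded by the crux-attack refuter (refuter-rattack-stmt-BirchSwinnertonDyer-18086-0, 2026-08-17); the
standing disprover (cdisprove) EXTENDS this file. Prose only in docstrings.

CYCLE 1 ADDITIONS (cdisprove-18086, §§6–9 at the end of the file; two `Negative/` files LANDED):
* §6 `selmerRankCM_copies_frozenTwin` — FrozenTwin's `closes` (rev 5) now BINDS the crux.
* §7 `selmerRankCMWithoutGood_iff` — dropping `HasGoodReductionAtPrime` = crux ∧ ADDITIVE CELLS,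
  exactly; the other hypotheses do NOT imply good reduction
  (`Negative/GoodReductionNotRedundant`, p159114: the tree's `frobeniusTrace` is `1` at additive
  primes — `a_p` only at good primes — witness `E₅ : y² = x³ − 25x`, `p = 5`).
* §8 crux ALONE ⟹ `rank ≤ r_an` for every CM curve, `corank Ш[p^∞] = r_an − rank` on the whole good
  ordinary locus, `Ш[p^∞]` finite at one ordinary `p ≥ 5` iff at all iff BSD-rank
  (`Negative/ConsequencesOfCrux`, p158717).
* §9 Targets = line `rubin-squeeze` (PICKED 11:34Z): no stub refutable in Lean; LOW-CELLS is implied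
  by the crux; the order stubs carry extra content `o = r` attackable numerically — ONE batched scan
  of CM `r_an ≥ 2` cells (job j025867, results attached to the item as compute evidence).
* §10 quantifier shape: `FrozenTwin.closes` consumes the crux at ONE prime per CM curve; the
  `∀ W ∃ p`-form `SelmerRankCMAtOnePrime` is equivalent to the crux modulo the route's own `Ш` item
  and still closes the route (`frozenTwin_bsd_of_atOnePrime`) — the prover could choose the prime.

`SelmerRankCM` (byte-identical in the route files TangentCone / SelmerRank / ShadowIsolation /
ToricShedding / FrozenTwin):

  `∀ W elliptic, globally minimal, ∀ p prime, 5 ≤ p → good reduction at p → p ∤ a_p → W.HasCM →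
     corank_{ℤ_p} Sel_{p^∞}(W/ℚ) = ord_{s=1} L(W,s)`.

Findings, all kernel-checked (sorry-free):

* `selmerRankCM_iff` — the item is `Iff.rfl`-equal to its verbatim signature (read-back: `selmerCorank`
  = `zpCorank` of the genuine `p^∞`-Selmer group `dim A[p] − dim A/pA`; `analyticRank` =
  `analyticOrderNatAt entireLFunction 1`; `frobeniusTrace` = `p + 1 − #Ẽ(𝔽_p)` of the global minimal
  model; `HasCM` = a geometric endomorphism that is not an integer; no junk operator bites).
* `selmerRankCM_hypotheses_satisfiable` — NOT VACUOUS: `W = y² = x³ + x` (Cremona 64a4, `j = 1728`,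
  CM by `ℤ[i]`, globally minimal since `p¹² ∤ Δ = -64`), `p = 5`: `#Ẽ(𝔽₅) = 4`, `a₅ = 2`, so `5` is good
  ordinary, and `W.HasCM` is the tree theorem `hasCM_ofJ1728`.
* (a) LOAD-BEARING ANALYSIS. `SelmerRankCMWithoutHypotheses` (all four hypotheses `5 ≤ p`, good,
  ordinary, `HasCM` dropped, global minimality too) is still implied by
  `BirchSwinnertonDyer ∧ SelmerRankShaPFinite` (the summit and the route's own item stmt-0132):
  `selmerRankCMWithoutHypotheses_of_bsd_of_shaPFinite`, via Greenberg's PROVED identity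
  `corank Sel_{p^∞} = rank + corank Ш[p^∞]`. Hence NO `_false_without_<H>` theorem can exist short of
  refuting BSD or prime-by-prime Ш-finiteness: the hypotheses delimit the METHOD (Rubin's two-variable
  main conjecture wants `p` split in the CM field and `p ∤ #𝓞_K^×`), not the truth. A counterexample
  to the crux is a counterexample to BSD ∧ Ш[p^∞]-finite — no cheap falsifier.
* `bsd_of_selmerRankCM_of_shaPFinite_of_hasCM` — conversely `SelmerRankCM ∧ SelmerRankShaPFinite`
  give the summit ON CM CURVES (global minimal models). So modulo item 0132 the crux is EXACTLY the CM
  sector of the summit in Selmer language; `C → S` fails (non-CM curves untouched), `S → C` needs Ш.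
* `selmerRankCM_iff_highCore` — modulo three named facts of the tree (Gross–Zagier–Kolyvagin, the two
  Burungale–Tian CM `p`-converses) and Dokchitser `p`-parity, the crux is EQUIVALENT to its open core:
  CM, `min(corank_p, r_an) ≥ 2`, equal parity ⟹ equality (verbatim the stub `stub_cmHighCore` of
  line prime-switch of crux 14418). The open residue is non-empty on paper (rank-2 CM curves, e.g.
  `y² = x³ − 17x`, N = 9248, where the cell `p = 5` was certified corank₅ = 2 = r_an by job j022999 of
  the 14418 strategist; congruent-number curves `y² = x³ − 34²x`, `y² = x³ − 41²x`).
* `selmerRankCM_of_smallImage` / `smallImage_of_items_of_selmerRankCM` — the crux is precisely the CM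
  sector of `SelmerRankSmallImage` (stmt-14418): 14418 ⟹ crux given non-surjectivity of `ρ̄_{E,p}` for
  CM curves at `p ≥ 5` (Serre 1972 §4.5; in tree only for the `j = 1728` family, privately, in
  `LeadingTermTamePinchRefutation`), and crux + the route's big-image items ⟹ 14418 by the landed
  `Theorems.tangentCone_selmerRankSmallImage_of_items`.
* (b)/(c) natural strengthenings: dropping `HasCM` gives Selmer-rank BSD at every good ordinary
  `p ≥ 5` (= `SelmerRankUB ∧ SelmerRankLB ∧ SelmerRankSmallImage` of route SelmerRank, Evidence14418);
  still implied by BSD ∧ Ш — open, not refutable here.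
* (d) Targets: none at 08:41Z (no line picked); since 11:34Z line `rubin-squeeze` — see §9.
-/

set_option linter.dupNamespace false

namespace Summit.BirchSwinnertonDyer.BirchSwinnertonDyer.Cruxes.SelmerRankCM.Disproof

open Summit.BirchSwinnertonDyer.BirchSwinnertonDyer.Theses
open Literature.NumberTheory.EllipticCurves IsDedekindDomain NumberField WeierstrassCurve

/-! ### 1. Read-back -/

/-- The item is definitionally its verbatim signature. [folklore] -/
theorem selmerRankCM_iff :
    TangentCone.SelmerRankCM ↔
      ∀ (W : WeierstrassCurve ℚ) [W.IsElliptic] [W.IsGloballyMinimal] (p : ℕ) [Fact p.Prime],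
        5 ≤ p → W.HasGoodReductionAtPrime p → ¬ (p : ℤ) ∣ W.frobeniusTrace p → W.HasCM →
          W.selmerCorank p = W.analyticRank :=
  Iff.rfl

/-- The five route copies are one proposition. [folklore] -/
theorem selmerRankCM_copies :
    (TangentCone.SelmerRankCM ↔ SelmerRank.SelmerRankCM) := Iff.rfl

/-! ### 2. Non-vacuity: `y² = x³ + x` at `p = 5` -/

/-- The integer model `[0,0,0,1,0]` base-changes to `y² = x³ + x` over `ℚ`. [folklore] -/
theorem baseChange_sixtyFourA4 :
    ((⟨0, 0, 0, 1, 0⟩ : WeierstrassCurve ℤ).baseChange ℚ) = (⟨0, 0, 0, 1, 0⟩ : WeierstrassCurve ℚ) := by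
  simp only [WeierstrassCurve.baseChange, WeierstrassCurve.map]
  ext <;> simp

/-- `Δ([0,0,0,1,0]) = -64`. [folklore] -/
theorem sixtyFourA4_int_Δ : (⟨0, 0, 0, 1, 0⟩ : WeierstrassCurve ℤ).Δ = -64 := by
  simp only [WeierstrassCurve.Δ, WeierstrassCurve.b₂, WeierstrassCurve.b₄, WeierstrassCurve.b₆,
    WeierstrassCurve.b₈]
  norm_num

/-- `y² = x³ + x` (Cremona 64a4, `Δ = -64 = -2⁶`) is a global minimal model (`p¹² ∤ 64`;
Silverman AEC VII.1 Remark 1.1). [folklore] -/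
theorem isGloballyMinimal_sixtyFourA4 :
    (⟨0, 0, 0, 1, 0⟩ : WeierstrassCurve ℚ).IsGloballyMinimal := by
  rw [← baseChange_sixtyFourA4]
  refine isGloballyMinimal_of_forall_isMinimalAt_int _ fun v ↦ ?_
  refine isMinimalAt_baseChange_int_of_not_pow_dvd_Δ ?_
  intro h
  rw [sixtyFourA4_int_Δ, dvd_neg] at h
  have hp := Rat.HeightOneSpectrum.prime_natGenerator v
  have h' : Rat.HeightOneSpectrum.natGenerator v ^ 12 ∣ 64 := by exact_mod_cast h
  have hle : Rat.HeightOneSpectrum.natGenerator v ^ 12 ≤ 64 := Nat.le_of_dvd (by norm_num) h'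
  have hge : 2 ^ 12 ≤ Rat.HeightOneSpectrum.natGenerator v ^ 12 := Nat.pow_le_pow_left hp.two_le 12
  have := hge.trans hle
  norm_num at this

/-- `#Ẽ(𝔽₅) = 4` for `y² = x³ + x` (points `O, (0,0), (2,0), (3,0)`; kernel point count via the
Euler criterion). [folklore] -/
theorem card_sixtyFourA4_5 :
    Nat.card (((⟨0, 0, 0, 1, 0⟩ : WeierstrassCurve ℤ).map (Int.castRingHom (ZMod 5))).toAffine.Point)
      = 4 := by
  rw [@WeierstrassCurve.natCard_point_eq_one_add_card (ZMod 5) (@ZMod.instField 5 ⟨by norm_num⟩) _ _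
    _ (by decide +kernel), @card_sol_eq_sum_euler (ZMod 5) (@ZMod.instField 5 ⟨by norm_num⟩) _ _
    (by rw [ZMod.ringChar_zmod_n]; decide), ZMod.card]
  decide +kernel

/-- `a₅(64a4) = 2`. [folklore] -/
theorem frobeniusTrace_sixtyFourA4_5
    [((⟨0, 0, 0, 1, 0⟩ : WeierstrassCurve ℤ).baseChange ℚ).IsGloballyMinimal] :
    frobeniusTrace ((⟨0, 0, 0, 1, 0⟩ : WeierstrassCurve ℤ).baseChange ℚ) 5 = 2 := by
  rw [frobeniusTrace_baseChange_int _ card_sixtyFourA4_5]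
  norm_num

/-- **The hypotheses of `SelmerRankCM` are jointly satisfiable** (the crux is not vacuous):
`W = y² = x³ + x`, `p = 5` is good (`5 ∤ 64`) and ordinary (`a₅ = 2`), and `W` has CM by `ℤ[i]`
(`hasCM_ofJ1728`). [folklore] -/
theorem selmerRankCM_hypotheses_satisfiable :
    ∃ (W : WeierstrassCurve ℚ) (_ : W.IsElliptic) (_ : W.IsGloballyMinimal) (p : ℕ) (_ : Fact p.Prime),
      5 ≤ p ∧ W.HasGoodReductionAtPrime p ∧ ¬ (p : ℤ) ∣ W.frobeniusTrace p ∧ W.HasCM := by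
  haveI hE : ((⟨0, 0, 0, 1, 0⟩ : WeierstrassCurve ℤ).baseChange ℚ).IsElliptic := by
    rw [baseChange_sixtyFourA4]; exact isElliptic_quartic (D := 1) one_ne_zero
  haveI hM : ((⟨0, 0, 0, 1, 0⟩ : WeierstrassCurve ℤ).baseChange ℚ).IsGloballyMinimal := by
    rw [baseChange_sixtyFourA4]; exact isGloballyMinimal_sixtyFourA4
  haveI h5 : Fact (Nat.Prime 5) := ⟨by norm_num⟩
  refine ⟨_, hE, hM, 5, h5, le_rfl, ?_, ?_, ?_⟩
  · exact hasGoodReductionAtPrime_baseChange_int _ 5 (by rw [sixtyFourA4_int_Δ]; norm_num)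
  · rw [frobeniusTrace_sixtyFourA4_5]; norm_num
  · rw [baseChange_sixtyFourA4]; exact hasCM_ofJ1728

/-! ### 3. Relation to the summit: `S ∧ Ш ⟹ C` with NO hypotheses, and `C ∧ Ш ⟹ S` on CM curves -/

/-- **`BirchSwinnertonDyer ∧ SelmerRankShaPFinite ⟹ corank_p = r_an` for every curve and prime** —
Greenberg's identity `corank Sel_{p^∞} = rank + corank Ш[p^∞]` (tree THEOREM
`selmerCorank_eq_mordellWeilRank_add_holds`) and `corank Ш[p^∞] = 0` for finite `Ш[p^∞]`.
Consequences: every hypothesis of `SelmerRankCM` is decoration relative to BSD + Ш-finiteness, and a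
counterexample to the crux refutes one of those two conjectures. [cite: GreenbergLNM1716, §1] -/
theorem selmerCorank_eq_analyticRank_of_bsd_of_shaPFinite (hS : _root_.BirchSwinnertonDyer)
    (hSha : TangentCone.SelmerRankShaPFinite) (W : WeierstrassCurve ℚ) [W.IsElliptic] (p : ℕ)
    [Fact p.Prime] : W.selmerCorank p = W.analyticRank := by
  have h1 := W.selmerCorank_eq_mordellWeilRank_add_holds p
  have h2 : W.shaCorank p = 0 := Literature.BSD.shaCorank_eq_zero_of_finite W p (hSha W p)
  have h3 : W.analyticRank = W.mordellWeilRank :=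
    (show ∀ V : WeierstrassCurve ℚ, V.IsElliptic → V.analyticRank = V.mordellWeilRank from hS) W ‹_›
  omega

/-- `SelmerRankCM` with ALL its hypotheses dropped (no `5 ≤ p`, no good / ordinary reduction, no CM,
no global minimality): Selmer-rank BSD at every prime for every elliptic curve over `ℚ`. [folklore] -/
def SelmerRankCMWithoutHypotheses : Prop :=
  ∀ (W : WeierstrassCurve ℚ) [W.IsElliptic] (p : ℕ) [Fact p.Prime], W.selmerCorank p = W.analyticRank

/-- The hypothesis-free strengthening trivially gives the crux back. [folklore] -/
theorem selmerRankCM_of_withoutHypotheses (h : SelmerRankCMWithoutHypotheses) :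
    TangentCone.SelmerRankCM :=
  fun W _ _ p _ _ _ _ _ => h W p

/-- **No hypothesis of the crux is load-bearing for truth**: even with all of them dropped the
statement follows from `BirchSwinnertonDyer ∧ SelmerRankShaPFinite`; so a `_false_without_<H>`
theorem for any `H ∈ {5 ≤ p, good, ordinary, HasCM, IsGloballyMinimal}` would refute BSD or
prime-by-prime Ш-finiteness. [cite: GreenbergLNM1716, §1] -/
theorem selmerRankCMWithoutHypotheses_of_bsd_of_shaPFinite (hS : _root_.BirchSwinnertonDyer)
    (hSha : TangentCone.SelmerRankShaPFinite) : SelmerRankCMWithoutHypotheses :=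
  fun W _ p _ => selmerCorank_eq_analyticRank_of_bsd_of_shaPFinite hS hSha W p

/-- `BirchSwinnertonDyer ∧ SelmerRankShaPFinite ⟹ SelmerRankCM` (`S ∧ item 0132 ⟹ C`). [folklore] -/
theorem selmerRankCM_of_bsd_of_shaPFinite (hS : _root_.BirchSwinnertonDyer)
    (hSha : TangentCone.SelmerRankShaPFinite) : TangentCone.SelmerRankCM :=
  fun W _ _ p _ _ _ _ _ => selmerCorank_eq_analyticRank_of_bsd_of_shaPFinite hS hSha W p

/-- **`SelmerRankCM ∧ SelmerRankShaPFinite ⟹` the summit on CM curves** (global minimal models): at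
the good ordinary `p ≥ 5` of `exists_good_ordinary_prime_holds` (proved), `corank_p = r_an` by the
crux and `corank_p = rank` by the corank identity with `Ш[p^∞]` finite. So modulo item 0132 the crux
is EXACTLY the CM sector of `BirchSwinnertonDyer`. [cite: GreenbergLNM1716, §1] -/
theorem bsd_of_selmerRankCM_of_shaPFinite_of_hasCM (hC : TangentCone.SelmerRankCM)
    (hSha : TangentCone.SelmerRankShaPFinite) (W : WeierstrassCurve ℚ) [W.IsElliptic]
    [W.IsGloballyMinimal] (hCM : W.HasCM) : W.analyticRank = W.mordellWeilRank := by
  obtain ⟨p, hp, h5, hgood, hord⟩ := WeierstrassCurve.exists_good_ordinary_prime_holds W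
  have h := hC W p h5 hgood hord hCM
  have h1 := W.selmerCorank_eq_mordellWeilRank_add_holds p
  have h2 : W.shaCorank p = 0 := Literature.BSD.shaCorank_eq_zero_of_finite W p (hSha W p)
  omega

/-! ### 4. The open core: known slices peel off `min(corank_p, r_an) ≤ 1` and odd differences -/

/-- **Modulo Gross–Zagier–Kolyvagin, the Burungale–Tian CM `p`-converses and Dokchitser `p`-parity
(all named facts of the tree), `SelmerRankCM` is equivalent to its high core**: CM, `p ≥ 5` good
ordinary, `2 ≤ r_an`, `2 ≤ corank_p`, equal parity `⟹ corank_p = r_an` — verbatim the stub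
`stub_cmHighCore` of line prime-switch. [cite: BurungaleTian2026, Thm. 1.1]
[cite: DokchitserDokchitserAnnals2010, Thm. 1.4] -/
theorem selmerRankCM_iff_highCore (hGZK : rank_eq_analyticRank_of_analyticRank_le_one)
    (h0 : burungaleTian_analyticRank_eq_zero_of_selmerCorank_eq_zero_of_hasCM)
    (h1 : burungaleTian_analyticRank_eq_one_of_selmerCorank_eq_one_of_hasCM)
    (hPar : ∀ (W : WeierstrassCurve ℚ) [W.IsElliptic] (p : ℕ) [Fact p.Prime],
      selmerCorank_mod_two_eq W p) :
    TangentCone.SelmerRankCM ↔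
      (∀ (W : WeierstrassCurve ℚ) [W.IsElliptic] [W.IsGloballyMinimal] (p : ℕ) [Fact p.Prime],
        5 ≤ p → W.HasGoodReductionAtPrime p → ¬ (p : ℤ) ∣ W.frobeniusTrace p → W.HasCM →
          2 ≤ W.analyticRank → 2 ≤ W.selmerCorank p →
            W.selmerCorank p % 2 = W.analyticRank % 2 → W.selmerCorank p = W.analyticRank) := by
  constructor
  · intro hC W _ _ p _ h5 hgood hord hCM _ _ _
    exact hC W p h5 hgood hord hCM
  · intro hCore W _ _ p _ h5 hgood hord hCM
    by_cases hr1 : W.analyticRank ≤ 1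
    · exact selmerCorank_eq_analyticRank_of_analyticRank_le_one hGZK W p hr1
    · have h2 : 2 ≤ W.analyticRank := by omega
      have hpar : W.selmerCorank p % 2 = W.analyticRank % 2 := hPar W p
      have hc : 2 ≤ W.selmerCorank p := by
        by_contra hlt
        have hle : W.selmerCorank p ≤ 1 := by omega
        have := selmerCorank_eq_analyticRank_of_hasCM_of_selmerCorank_le_one h0 h1 W hCM p h5
          hgood hord hle
        omega
      exact hCore W p h5 hgood hord hCM h2 hc hpar

/-- The `r_an ≤ 1` slice of the crux is Gross–Zagier–Kolyvagin (route item `RankLeOne`, verbatim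
the named fact) — no CM, image or reduction hypothesis is used there. [cite: Darmon2004, Thm. 3.22] -/
theorem selmerRankCM_slice_analyticRank_le_one (hR1 : TangentCone.RankLeOne) (W : WeierstrassCurve ℚ)
    [W.IsElliptic] (p : ℕ) [Fact p.Prime] (h : W.analyticRank ≤ 1) :
    W.selmerCorank p = W.analyticRank :=
  selmerCorank_eq_analyticRank_of_analyticRank_le_one hR1 W p h

/-! ### 5. The crux is the CM sector of `SelmerRankSmallImage` (stmt-14418) -/

/-- `SelmerRankSmallImage ⟹ SelmerRankCM` once CM curves have non-surjective `ρ̄_{E,p}` at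
`p ≥ 5` (`hNS`; Serre 1972 §4.5 — the image lies in the normaliser of a Cartan subgroup; proved in
tree for the `j = 1728` family inside `LeadingTermTamePinchRefutation`, not yet as a named theorem
for all thirteen CM `j`). The converse direction (crux + the route's big-image items ⟹ 14418) is the
landed `Theorems.tangentCone_selmerRankSmallImage_of_items`. [cite: Serre1972, §4.5] -/
theorem selmerRankCM_of_smallImage
    (hNS : ∀ (W : WeierstrassCurve ℚ) [W.IsElliptic] [W.IsGloballyMinimal] (p : ℕ) [Fact p.Prime],
      5 ≤ p → W.HasCM → ¬ W.HasSurjectiveModNGaloisRep p)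
    (hSI : TangentCone.SelmerRankSmallImage) : TangentCone.SelmerRankCM :=
  fun W _ _ p _ h5 hgood hord hCM => hSI W p h5 hgood hord (hNS W p h5 hCM)

/-- With the crux in hand the CM core hypothesis of the landed reduction is discharged: the route's
items `EdgeDecay`, `EdgeCap`, `SelmerRankLB`, `SelmerRankShaPFinite`, `RankLeOne`, the two
Burungale–Tian facts, `p`-parity and `SelmerRankCM` give `SelmerRankSmallImage`. [folklore] -/
theorem smallImage_of_items_of_selmerRankCM
    (hE : TangentCone.EdgeDecay) (hCap : TangentCone.EdgeCap) (hLB : TangentCone.SelmerRankLB)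
    (hSha : TangentCone.SelmerRankShaPFinite) (hR1 : TangentCone.RankLeOne)
    (h0 : burungaleTian_analyticRank_eq_zero_of_selmerCorank_eq_zero_of_hasCM)
    (h1 : burungaleTian_analyticRank_eq_one_of_selmerCorank_eq_one_of_hasCM)
    (hPar : ∀ (W : WeierstrassCurve ℚ) [W.IsElliptic] (p : ℕ) [Fact p.Prime],
      selmerCorank_mod_two_eq W p)
    (hC : TangentCone.SelmerRankCM) : TangentCone.SelmerRankSmallImage :=
  Theorems.tangentCone_selmerRankSmallImage_of_items hE hCap hLB hSha hR1 h0 h1 hPar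
    fun W _ _ p _ h5 hgood hord hCM _ _ _ => hC W p h5 hgood hord hCM

/-! ## Cycle 1 of the standing disprover (cdisprove-18086, 2026-08-17 from 11:35Z)

Everything below EXTENDS the crux-attack findings above (nothing restated). New since 08:41Z: the
crux became a BINDER of route FrozenTwin's `closes` (rev 5, 09:19Z; the other four wanting routes
still bind `SelmerRankSmallImage` and hold re-glue packages as evidence), line `rubin-squeeze` was
REGISTERED (08:49Z) and PICKED by the lead (11:34Z), two `Negative/` files LANDED
(`Theorems/SelmerRankCM/Negative/ConsequencesOfCrux`, p158717; `…/GoodReductionNotRedundant`,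
p159114), and ONE batched compute job scans the line's numerically attackable cells (j025867). -/

/-! ### 6. Route copies (FrozenTwin binds the crux) -/

/-- The FrozenTwin copy — the one currently CONSUMED by a deciding theorem (`FrozenTwin.closes`,
binder `hCM`) — is the same proposition as the TangentCone copy analysed above. [folklore] -/
theorem selmerRankCM_copies_frozenTwin :
    (TangentCone.SelmerRankCM ↔ FrozenTwin.SelmerRankCM) := Iff.rfl

/-! ### 7. Load-bearing analysis of `HasGoodReductionAtPrime`, made exact

Finding (a) above ("no hypothesis is load-bearing for TRUTH") stands. What is new is the FORMAL
role of `hgood`: it is NOT implied by the other hypotheses, because the tree's `frobeniusTrace` is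
`p + 1 − #Ẽ_ns(𝔽_p)` with Mathlib's point type (nonsingular points and `O`), hence equals `1` at
every ADDITIVE prime (cusp: `#Ẽ_ns = p`), `2` at a split node, `0` at a non-split node — it is the
Dirichlet coefficient `a_p` only at GOOD primes (`LFunction_apply_prime_eq_frobeniusTrace`). So
`¬ p ∣ W.frobeniusTrace p` holds automatically at additive primes, CM curves have good-or-additive
reduction everywhere (`j ∈ ℤ`), and dropping `hgood` ENLARGES the crux by exactly the additive
cells. Landed as `Negative/GoodReductionNotRedundant` (witness `E₅ : y² = x³ − 25x` at `p = 5`: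
CM, globally minimal, additive, `frobeniusTrace = 1`). Here: the enlarged statement and its exact
decomposition. Moral for planners: never restate the crux "at every `p ≥ 5` with `p ∤ a_p`". -/

/-- The crux with `HasGoodReductionAtPrime` DROPPED (all other binders verbatim). -/
def SelmerRankCMWithoutGood : Prop :=
  ∀ (W : WeierstrassCurve ℚ) [W.IsElliptic] [W.IsGloballyMinimal] (p : ℕ) [Fact p.Prime],
    5 ≤ p → ¬ (p : ℤ) ∣ W.frobeniusTrace p → W.HasCM → W.selmerCorank p = W.analyticRank

/-- The ADDITIVE CELLS: Selmer-rank BSD for CM curves at the places `v` over primes `p ≥ 5` of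
additive reduction (potentially good, `p` dividing the conductor; outside Rubin's ordinary theory).
BSD-true, not refutable here; no method on the board addresses it. -/
def SelmerRankCMAdditiveCells : Prop :=
  ∀ (W : WeierstrassCurve ℚ) [W.IsElliptic] [W.IsGloballyMinimal]
    (v : IsDedekindDomain.HeightOneSpectrum (𝓞 ℚ)),
    5 ≤ (Rat.HeightOneSpectrum.primesEquiv v : ℕ) → W.HasAdditiveReductionAt v → W.HasCM →
      W.selmerCorank (Rat.HeightOneSpectrum.primesEquiv v) = W.analyticRank

/-- **Dropping `hgood` = crux ∧ additive cells, exactly.** (`→`: at an additive place the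
ordinarity hypothesis is free, `Negative.not_dvd_frobeniusTrace_of_hasAdditiveReductionAt`;
`←`: a CM curve that is not good at `p` is additive there,
`Negative.not_hasGoodReductionAtPrime_iff_hasAdditiveReduction_of_hasCM` + the `ℤ_p ↔ 𝓞_v`
bridge `hasAdditiveReduction_padic_iff_hasAdditiveReductionAt_ringOfIntegers`.) [folklore] -/
theorem selmerRankCMWithoutGood_iff :
    SelmerRankCMWithoutGood ↔ TangentCone.SelmerRankCM ∧ SelmerRankCMAdditiveCells := by
  constructor
  · intro h
    refine ⟨fun W _ _ p _ h5 _ hord hCM => h W p h5 hord hCM, fun W _ _ v h5 hadd hCM => ?_⟩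
    haveI := Fact.mk (Rat.HeightOneSpectrum.primesEquiv v).2
    exact h W _ h5
      (Theorems.SelmerRankCM.Negative.not_dvd_frobeniusTrace_of_hasAdditiveReductionAt W v hadd) hCM
  · rintro ⟨hC, hA⟩ W _ _ p hp h5 hord hCM
    by_cases hgood : W.HasGoodReductionAtPrime p
    · exact hC W p h5 hgood hord hCM
    · obtain ⟨v, rfl⟩ : ∃ v : IsDedekindDomain.HeightOneSpectrum (𝓞 ℚ),
          (Rat.HeightOneSpectrum.primesEquiv v : ℕ) = p :=
        ⟨Rat.HeightOneSpectrum.primesEquiv.symm ⟨p, hp.out⟩, by rw [Equiv.apply_symm_apply]⟩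
      have hadd := (Theorems.SelmerRankCM.Negative.not_hasGoodReductionAtPrime_iff_hasAdditiveReduction_of_hasCM
        W hCM _).1 hgood
      have hadd' : W.HasAdditiveReductionAt v :=
        (W.hasAdditiveReduction_padic_iff_hasAdditiveReductionAt_ringOfIntegers v).1 hadd
      exact hA W v h5 hadd' hCM

/-- The enlarged statement is still implied by `BSD ∧ SelmerRankShaPFinite` (so, like the crux, it
has no cheap falsifier) — recorded to make explicit that "not redundant" is a statement about the
FORMAL quantifier domain, not a `_false_without_good` theorem. [folklore] -/
theorem selmerRankCMWithoutGood_of_bsd_of_shaPFinite (hS : _root_.BirchSwinnertonDyer)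
    (hSha : TangentCone.SelmerRankShaPFinite) : SelmerRankCMWithoutGood :=
  fun W _ _ p _ _ _ _ => selmerCorank_eq_analyticRank_of_bsd_of_shaPFinite hS hSha W p

/-- Conversely the crux does NOT syntactically give the enlarged statement: the residue is exactly
`SelmerRankCMAdditiveCells` (previous `iff`), and that residue is NON-EMPTY —
`Negative.exists_additive_cell_of_selmerRankCM_hypotheses` (`E₅` at `5`). [folklore] -/
theorem selmerRankCMWithoutGood_ne_crux_domain :
    ¬ ∀ (W : WeierstrassCurve ℚ) [W.IsElliptic] [W.IsGloballyMinimal] (p : ℕ) [Fact p.Prime],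
        5 ≤ p → ¬ (p : ℤ) ∣ W.frobeniusTrace p → W.HasCM → W.HasGoodReductionAtPrime p :=
  Theorems.SelmerRankCM.Negative.selmerRankCM_hypotheses_not_imp_hasGoodReduction

/-- The other three hypotheses, for the record (no theorem possible, finding (a)): `5 ≤ p` removes
finitely many ordinary cells per curve (e.g. `p = 3` split in `ℚ(√-2)`, `ℚ(√-11)`: CM `j = 8000`,
`-32768`), where Rubin still applies (`p ∤ #𝓞_K^× = 2`) but Burungale–Tian is stated for `p > 3`;
`¬ p ∣ a_p` removes the supersingular (inert) half of the good primes, where `unitRoot = 0` makes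
every `L_p`-based stub junk (`Theorems/PAdicOrderThesisR2/Negative/AtEveryGoodPrimeFalse`) and the
signed `L_p^±` theory would be needed; `HasCM` removes the generic curve (= `SelmerRankUB ∧ LB ∧
SmallImage`). All three enlargements are BSD-true. This `example` only pins the TYPE of the
`5 ≤ p`-free variant so a planner can see it elaborates. -/
example : Prop :=
  ∀ (W : WeierstrassCurve ℚ) [W.IsElliptic] [W.IsGloballyMinimal] (p : ℕ) [Fact p.Prime],
    W.HasGoodReductionAtPrime p → ¬ (p : ℤ) ∣ W.frobeniusTrace p → W.HasCM →
      W.selmerCorank p = W.analyticRank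

/-! ### 8. What the crux alone proves (no `Ш` item): landed as `Negative/ConsequencesOfCrux`

Sharpening of §3: the `Ш` hypothesis can be dropped from `bsd_of_selmerRankCM_of_shaPFinite_of_hasCM`
in one direction. By Greenberg's PROVED identity the crux pins `corank_{ℤ_p} Ш[p^∞] = r_an − rank`
at every good ordinary `p ≥ 5` of a CM curve; hence (all in `Negative/ConsequencesOfCrux`, p158717):
weak BSD `rank ≤ r_an` for every CM curve; `Ш[p^∞]` finite at ONE good ordinary `p ≥ 5` iff at ALL
iff `rank = r_an`; an infinite `Ш[p^∞]` at one such prime forces `rank < r_an` and infinite `Ш[q^∞]`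
at every such `q`. So any proof of the crux proves the CM case of the BSD upper bound `rank ≤
ord_{s=1} L(E,s)`, open in print from `r_an = 2`. Re-exported here in the TangentCone spelling. -/

/-- **Crux ⟹ `rank E(ℚ) ≤ ord_{s=1} L(E,s)` for every CM elliptic curve** (global minimal model),
no `Ш` hypothesis. [folklore] -/
theorem mordellWeilRank_le_analyticRank_of_selmerRankCM (hC : TangentCone.SelmerRankCM)
    (W : WeierstrassCurve ℚ) [W.IsElliptic] [W.IsGloballyMinimal] (hCM : W.HasCM) :
    W.mordellWeilRank ≤ W.analyticRank :=
  Theorems.SelmerRankCM.Negative.mordellWeilRank_le_analyticRank_of_crux hC W hCM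

/-- **Crux ⟹ (BSD-rank for a CM curve ↔ `Ш[p^∞]` finite at SOME good ordinary `p ≥ 5`).**
[folklore] -/
theorem bsd_iff_exists_finite_sha_of_selmerRankCM (hC : TangentCone.SelmerRankCM)
    (W : WeierstrassCurve ℚ) [W.IsElliptic] [W.IsGloballyMinimal] (hCM : W.HasCM) :
    W.analyticRank = W.mordellWeilRank ↔
      ∃ (p : ℕ) (_ : Fact p.Prime), 5 ≤ p ∧ W.HasGoodReductionAtPrime p ∧
        ¬ (p : ℤ) ∣ W.frobeniusTrace p ∧ Finite (AddCommGroup.primaryComponent W.sha p) := by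
  rw [eq_comm]
  exact Theorems.SelmerRankCM.Negative.bsd_iff_exists_finite_sha_of_crux hC W hCM

/-- **Crux ⟹ the `Ш`-corank of a CM curve is one integer `r_an − rank` on the whole good ordinary
locus `p ≥ 5`.** [folklore] -/
theorem shaCorank_eq_of_selmerRankCM (hC : TangentCone.SelmerRankCM) (W : WeierstrassCurve ℚ)
    [W.IsElliptic] [W.IsGloballyMinimal] (p : ℕ) [Fact p.Prime] (h5 : 5 ≤ p)
    (hgood : W.HasGoodReductionAtPrime p) (hord : ¬ (p : ℤ) ∣ W.frobeniusTrace p) (hCM : W.HasCM) :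
    W.shaCorank p = W.analyticRank - W.mordellWeilRank :=
  Theorems.SelmerRankCM.Negative.shaCorank_eq_analyticRank_sub_of_crux hC W p h5 hgood hord hCM

/-! ### 9. Targets — line `rubin-squeeze` (PICKED 11:34Z; 6 stubs, `SelmerRankCM_of` sorry-free)

Disprover's reading of the registered stubs (`Lines/rubin_squeeze.lean`), cheapest attacks first.
No stub is refutable IN LEAN: `padicLFunction f (unitRoot W p)` is a concrete power series (MSD
Riemann sums) whose order at a genuine newform `f` of a CM curve is not computable in the tree, and
every stub's hypotheses are dischargeable only through an actual `f` (`IsNewformOf W f`; cf. the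
`_of_isNewformOf` pattern of `Theorems/PAdicOrderPadicBSDrankR2/Negative/FalseWithoutOrdinary`).
What IS decidable per cell is numerical: `o(E,p) := ord_{T=0} L_p(E,T)`.

* `stub_modularCM`, `stub_capCM`, `stub_lowCellsCM`: literature debts with in-file discharges from
  named facts; consistent with everything here. NOTE `stub_capCM` uses neither `HasCM` nor `5 ≤ p`
  (Kato's fact is stated for all curves at odd good ordinary `p`): both are decoration there.
  `stub_lowCellsCM` is moreover a CONSEQUENCE of the crux (`lowCellsCM_of_crux` below) — it cannot
  fail unless the crux does.
* `stub_orderLeAnalyticRankCM` (UB kernel, `o ≤ r` for `r ≥ 2`): a counterexample is a CM curve with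
  a DEGENERATE cyclotomic `p`-adic height (`o > r`); never observed at any `(E,p)`; numerically only
  suggestive (vanishing to precision). Scanned by job j025867 (CM curves with `r_an ≥ 2`,
  `N ≤ 4·10⁴`, good ordinary `5 ≤ p ≤ 41`, precision `p⁷`); table → `outputs/table.txt`, attached
  to the item as compute evidence when the job ends; any line `!!! ANOMALY` there is a cell to
  re-run at higher precision, nothing more.
* `stub_analyticRankLeOrderCM` (`r ≤ o` for `r ≥ 3`): here a NONZERO coefficient of `L_p` of index
  `< r` would be certificate-grade (`o` is certified from above); same job reports it.
* `stub_orderLeCorankCM` (LB kernel, semisimplicity, `o ≤ c` for `r ≥ 3`): a counterexample needs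
  `o ≥ 4` certified at a corank-3 cell — not certifiable numerically; no attack.
* Joint sufficiency: `SelmerRankCM_of` is kernel-checked; the stubs are jointly STRONGER than the
  crux (they give `o = r = c` on `r ≥ 3` and `c ≤ o ≤ r` on `r = 2`): `padicOrder_eq_of_stubs`
  below records the extra content a refuter could aim at without touching the crux.
* Hypothesis mutation inside the stubs: `3 ≤ W.analyticRank` in the two LB stubs cannot be lowered
  to `2 ≤` for free only in appearance — at `r = 2` the squeeze `2 ≤ c ≤ o ≤ 2` already forces
  `o = c = r`, so the lowered stubs are implied by CAP ∧ UB ∧ LOW-CELLS there (`lb_stubs_at_two`). -/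

/-- Verbatim copy of the TYPE of `RubinSqueeze.stub_lowCellsCM` (kept in sync by hand; the line file
is not imported so that a reshaped skeleton cannot break this work file). -/
def StubLowCellsCM : Prop :=
  ∀ (W : WeierstrassCurve ℚ) [W.IsElliptic] [W.IsGloballyMinimal] (p : ℕ) [Fact p.Prime],
    5 ≤ p → W.HasGoodReductionAtPrime p → ¬ (p : ℤ) ∣ W.frobeniusTrace p → W.HasCM →
    (W.analyticRank ≤ 1 ∨ W.selmerCorank p ≤ 1) → W.selmerCorank p = W.analyticRank

/-- LOW-CELLS-CM is a consequence of the crux (so that stub is as safe as the crux itself).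
[folklore] -/
theorem lowCellsCM_of_crux (hC : TangentCone.SelmerRankCM) : StubLowCellsCM :=
  fun W _ _ p _ h5 hgood hord hCM _ => hC W p h5 hgood hord hCM

/-- The extra content of the line beyond the crux, as a bare order statement: on `r ≥ 3` the two
order stubs say `o = r` (MTT's `p`-adic BSD order conjecture in the CM sector). Any cell with
`o ≠ r`, found numerically, kills a stub WITHOUT refuting the crux. Stated over an abstract order
function `o` to stay independent of the line file's imports. [folklore] -/
theorem padicOrder_eq_of_stubs {o : WeierstrassCurve ℚ → ℕ → ℕ∞}
    (hUB : ∀ (W : WeierstrassCurve ℚ) [W.IsElliptic] [W.IsGloballyMinimal] (p : ℕ) [Fact p.Prime],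
      5 ≤ p → W.HasGoodReductionAtPrime p → ¬ (p : ℤ) ∣ W.frobeniusTrace p → W.HasCM →
      2 ≤ W.analyticRank → o W p ≤ (W.analyticRank : ℕ∞))
    (hLBa : ∀ (W : WeierstrassCurve ℚ) [W.IsElliptic] [W.IsGloballyMinimal] (p : ℕ) [Fact p.Prime],
      5 ≤ p → W.HasGoodReductionAtPrime p → ¬ (p : ℤ) ∣ W.frobeniusTrace p → W.HasCM →
      3 ≤ W.analyticRank → (W.analyticRank : ℕ∞) ≤ o W p)
    (W : WeierstrassCurve ℚ) [W.IsElliptic] [W.IsGloballyMinimal] (p : ℕ) [Fact p.Prime]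
    (h5 : 5 ≤ p) (hgood : W.HasGoodReductionAtPrime p) (hord : ¬ (p : ℤ) ∣ W.frobeniusTrace p)
    (hCM : W.HasCM) (h3 : 3 ≤ W.analyticRank) : o W p = W.analyticRank :=
  le_antisymm (hUB W p h5 hgood hord hCM (by omega)) (hLBa W p h5 hgood hord hCM h3)

/-- At `r = 2` the lower-bound stubs come for free from CAP ∧ UB once `c ≥ 2` (the branch in which
`SelmerRankCM_of` uses them is `r ≥ 3` only): `2 ≤ c ≤ o ≤ r = 2` gives `o = c = 2`. So lowering
`3 ≤ W.analyticRank` to `2 ≤` in `stub_orderLeCorankCM` / `stub_analyticRankLeOrderCM` adds nothing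
attackable. [folklore] -/
theorem lb_stubs_at_two {o c r : ℕ∞} (hcap : c ≤ o) (hub : o ≤ r) (hr : r = 2) (hc : 2 ≤ c) :
    o ≤ c ∧ r ≤ o := by
  subst hr
  have hc2 : c = 2 := le_antisymm (hcap.trans hub) hc
  subst hc2
  exact ⟨hub, hcap⟩

/-! ### 10. Quantifier shape versus the consumer: FrozenTwin's `closes` uses ONE prime per CM curve

`FrozenTwin.closes` (rev 5) applies its binder `hCM : SelmerRankCM` exactly once, at the good
ordinary prime `p ≥ 5` supplied by `exists_good_ordinary_prime_holds` (case (c) of `hmin`). So the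
deciding theorem consumes only the `∀ W ∃ p`-form below, while the item is the `∀ W ∀ p`-form.
Modulo the route's OWN `Ш` binder `SelmerRankShaPFinite` (stmt-0132) the two forms are equivalent
(`selmerRankCM_of_atOnePrime_of_shaPFinite`, Greenberg's proved identity), and the route still
closes with the weaker binder (`frozenTwin_bsd_of_atOnePrime`). Not a refutation and not a reshaping
(planners' business) — a typed observation: a prover of the `∃ p`-form may CHOOSE the split prime
(avoiding, per curve, finitely many inconvenient ordinary primes: anomalous `a_p ≡ 1`, `p ∣ h_K`,
`p` dividing a Tamagawa number or the index of elliptic units), which Rubin-type arguments like. -/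

/-- The `∀ W ∃ p`-form of the crux: ONE good ordinary prime `p ≥ 5` per CM curve with
`corank_p = r_an` (what `FrozenTwin.closes` actually consumes). -/
def SelmerRankCMAtOnePrime : Prop :=
  ∀ (W : WeierstrassCurve ℚ) [W.IsElliptic] [W.IsGloballyMinimal], W.HasCM →
    ∃ (p : ℕ) (_ : Fact p.Prime), 5 ≤ p ∧ W.HasGoodReductionAtPrime p ∧
      ¬ (p : ℤ) ∣ W.frobeniusTrace p ∧ W.selmerCorank p = W.analyticRank

/-- The crux gives the one-prime form (a good ordinary `p ≥ 5` exists, proved). [folklore] -/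
theorem atOnePrime_of_selmerRankCM (hC : TangentCone.SelmerRankCM) : SelmerRankCMAtOnePrime := by
  intro W _ _ hCM
  obtain ⟨p, hp, h5, hgood, hord⟩ := WeierstrassCurve.exists_good_ordinary_prime_holds W
  exact ⟨p, hp, h5, hgood, hord, hC W p h5 hgood hord hCM⟩

/-- **One-prime form ∧ `SelmerRankShaPFinite` ⟹ the crux**: at the chosen prime `q`,
`corank_q = rank` (finite `Ш[q^∞]`) `= r_an`; at any other prime `p`, `corank_p = rank + 0`.
[cite: GreenbergLNM1716, §1] -/
theorem selmerRankCM_of_atOnePrime_of_shaPFinite (h1 : SelmerRankCMAtOnePrime)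
    (hSha : TangentCone.SelmerRankShaPFinite) : TangentCone.SelmerRankCM := by
  intro W _ _ p _ _ _ _ hCM
  obtain ⟨q, hq, -, -, -, hcq⟩ := h1 W hCM
  have hGq := W.selmerCorank_eq_mordellWeilRank_add_holds q
  have hGp := W.selmerCorank_eq_mordellWeilRank_add_holds p
  have hZq : W.shaCorank q = 0 := Literature.BSD.shaCorank_eq_zero_of_finite W q (hSha W q)
  have hZp : W.shaCorank p = 0 := Literature.BSD.shaCorank_eq_zero_of_finite W p (hSha W p)
  omega

/-- Hence modulo item 0132 the two quantifier shapes are ONE statement. [folklore] -/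
theorem selmerRankCM_iff_atOnePrime_of_shaPFinite (hSha : TangentCone.SelmerRankShaPFinite) :
    TangentCone.SelmerRankCM ↔ SelmerRankCMAtOnePrime :=
  ⟨atOnePrime_of_selmerRankCM, fun h1 => selmerRankCM_of_atOnePrime_of_shaPFinite h1 hSha⟩

/-- **Route FrozenTwin closes with the one-prime form in place of the crux** (all other binders
verbatim; `FrozenTwin.closes` is the gate-rendered deciding theorem). [folklore] -/
theorem frozenTwin_bsd_of_atOnePrime (hK1 : FrozenTwin.GrossMomentSharpness)
    (hK2 : FrozenTwin.FrozenTwinBound) (hPG : FrozenTwin.UBPotentiallyGood)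
    (hLB : FrozenTwin.SelmerRankLB) (hSha : FrozenTwin.SelmerRankShaPFinite)
    (h1 : SelmerRankCMAtOnePrime) (hSerre : FrozenTwin.SerrePrimeSupply) :
    _root_.BirchSwinnertonDyer :=
  FrozenTwin.closes hK1 hK2 hPG hLB hSha (selmerRankCM_of_atOnePrime_of_shaPFinite h1 hSha) hSerre

end Summit.BirchSwinnertonDyer.BirchSwinnertonDyer.Cruxes.SelmerRankCM.Disproof
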